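import Summits.Ventures.DiscreteObjects.PP12.FanoFiveECodeNormal

/-!
# PP(12), order 5: the normalized coding statement as a statement about a 16-set of 7-bit WORDS (kernel; the input format of a kernel certificate)
Framing: lottery ticket; floor = certified bounds/negative ranges.

Cell pub-namedobj (venture DiscreteObjects), target (M), designs gen 17. A normalized E-code (`FanoFiveECodeNormal`: `IsNormalized E ∧ IsECode E`) is turned
into a set `W ⊆ {0,…,127}` of sixteen 7-bit words (`wordOf`: bit `x` set iff the entry is `−1`; `Nat.ofBits` of Batteries) containing `0, 95, 63` (rows `0, 1, 2`),
balanced (every bit set in exactly `8` words), with Hamming-distance profile `(4, 9, 2)` at distances `(2, 4, 6)` from every word and every bit pair differing in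
`6, 8` or `10` words: `FanoFive.IsWordCode W`. Hence **`noECodeNF_of_noWordCode : NoWordCode → NoECodeNF`** (and with `FanoFiveECodeNormal`, `FanoFiveECode`:
`NoWordCode → NoOrderFiveOrder12`, `noOrderFive_of_noWordCode`). `NoWordCode` is exactly what designs g17's engine `ecode2.c` / designs g10's `codeB.c` decide
(EMPTY, two engines, outside the kernel) and what a kernel certificate would establish by `decide` over the DFS (HANDOFF item (c); prototype code/cert/).
Nothing here asserts any census statement. No `sorry`, no new axioms.
-/

namespace Summit.Ventures.DiscreteObjects.PP12

open Finset

namespace FanoFive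

/-- the 7-bit word of a sign vector: bit `x` is set iff the entry is `−1` -/
def wordOf (v : Fin 7 → ℤ) : ℕ := Nat.ofBits fun x : Fin 7 => decide (v x = -1)

/-- Hamming distance of two words on the seven low bits -/
def hdist (v w : ℕ) : ℕ := (univ.filter fun x : Fin 7 => v.testBit x ≠ w.testBit x).card

/-- **a 16-set of words with the properties of a normalized E-code** (the input of the engines / of a kernel certificate) -/
structure IsWordCode (W : Finset ℕ) : Prop where
  /-- sixteen words -/
  card_eq : W.card = 16
  /-- 7-bit words -/
  lt : ∀ w ∈ W, w < 128
  /-- the zero word (row `0`) -/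
  zero_mem : 0 ∈ W
  /-- the word `95 = 1011111₂` (row `1`: all bits but `5`) -/
  w5_mem : 95 ∈ W
  /-- the word `63 = 0111111₂` (row `2`: all bits but `6`) -/
  w6_mem : 63 ∈ W
  /-- every bit is set in exactly eight words -/
  balanced : ∀ x : Fin 7, (W.filter fun w => w.testBit x = true).card = 8
  /-- exactly two words at distance `6` from every word -/
  six : ∀ v ∈ W, (W.filter fun w => hdist v w = 6).card = 2
  /-- exactly nine words at distance `4` from every word -/
  four : ∀ v ∈ W, (W.filter fun w => hdist v w = 4).card = 9
  /-- exactly four words at distance `2` from every word -/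
  two : ∀ v ∈ W, (W.filter fun w => hdist v w = 2).card = 4
  /-- every pair of bits differs in `6`, `8` or `10` words -/
  corr : ∀ x y : Fin 7, x ≠ y → (W.filter fun w => w.testBit x ≠ w.testBit y).card = 6 ∨
    (W.filter fun w => w.testBit x ≠ w.testBit y).card = 8 ∨ (W.filter fun w => w.testBit x ≠ w.testBit y).card = 10

/-- **census statement at the word level (typed; decided EMPTY outside the kernel by two engines)** -/
def NoWordCode : Prop := ∀ W : Finset ℕ, ¬ IsWordCode W

/-- the bits of `wordOf` -/
theorem testBit_wordOf (v : Fin 7 → ℤ) (x : Fin 7) : (wordOf v).testBit x = decide (v x = -1) := by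
  unfold wordOf
  rw [Nat.testBit_ofBits_lt _ _ x.isLt]

/-- `wordOf` is a 7-bit word -/
theorem wordOf_lt (v : Fin 7 → ℤ) : wordOf v < 128 := Nat.ofBits_lt_two_pow _

/-- `wordOf` is injective on sign vectors -/
theorem wordOf_inj {u v : Fin 7 → ℤ} (hu : ∀ x, u x = 1 ∨ u x = -1) (hv : ∀ x, v x = 1 ∨ v x = -1) (h : wordOf u = wordOf v) : u = v := by
  funext x
  have e := congrArg (fun w => Nat.testBit w x) h
  simp only [testBit_wordOf] at e
  rcases hu x with h1 | h1 <;> rcases hv x with h2 | h2 <;> rw [h1, h2] at e ⊢ <;> first | rfl | (revert e; decide)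

/-- Hamming distance of words = number of coordinates where the sign vectors differ -/
theorem hdist_wordOf {u v : Fin 7 → ℤ} (hu : ∀ x, u x = 1 ∨ u x = -1) (hv : ∀ x, v x = 1 ∨ v x = -1) :
    hdist (wordOf u) (wordOf v) = (univ.filter fun x : Fin 7 => u x ≠ v x).card := by
  unfold hdist
  congr 1
  ext x
  simp only [Finset.mem_filter, Finset.mem_univ, true_and, testBit_wordOf]
  rcases hu x with h1 | h1 <;> rcases hv x with h2 | h2 <;> rw [h1, h2] <;> decide

/-- inner product of sign vectors in terms of the number of differing coordinates -/
theorem inner_signs {u v : Fin 7 → ℤ} (hu : ∀ x, u x = 1 ∨ u x = -1) (hv : ∀ x, v x = 1 ∨ v x = -1) :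
    ∑ x, u x * v x = 7 - 2 * ((univ.filter fun x : Fin 7 => u x ≠ v x).card : ℤ) := by
  have e : ∀ x, u x * v x = 1 - 2 * (if u x ≠ v x then 1 else 0 : ℤ) := by
    intro x
    rcases hu x with h1 | h1 <;> rcases hv x with h2 | h2 <;> norm_num [h1, h2]
  rw [Finset.sum_congr rfl fun x _ => e x, Finset.sum_sub_distrib, ← Finset.mul_sum, Finset.sum_boole]
  simp

/-- a column sum of a sign matrix in terms of the number of `−1` entries -/
theorem colsum_signs {E : Fin 16 → Fin 7 → ℤ} (hE : ∀ O x, E O x = 1 ∨ E O x = -1) (x : Fin 7) :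
    ∑ O, E O x = 16 - 2 * ((univ.filter fun O : Fin 16 => E O x = -1).card : ℤ) := by
  have e : ∀ O, E O x = 1 - 2 * (if E O x = -1 then 1 else 0 : ℤ) := by
    intro O; rcases hE O x with h1 | h1 <;> norm_num [h1]
  rw [Finset.sum_congr rfl fun O _ => e O, Finset.sum_sub_distrib, ← Finset.mul_sum, Finset.sum_boole]
  simp

/-- a column-pair correlation of a sign matrix in terms of the number of rows where the two columns differ -/
theorem corr_signs {E : Fin 16 → Fin 7 → ℤ} (hE : ∀ O x, E O x = 1 ∨ E O x = -1) (x y : Fin 7) :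
    ∑ O, E O x * E O y = 16 - 2 * ((univ.filter fun O : Fin 16 => E O x ≠ E O y).card : ℤ) := by
  have e : ∀ O, E O x * E O y = 1 - 2 * (if E O x ≠ E O y then 1 else 0 : ℤ) := by
    intro O; rcases hE O x with h1 | h1 <;> rcases hE O y with h2 | h2 <;> norm_num [h1, h2]
  rw [Finset.sum_congr rfl fun O _ => e O, Finset.sum_sub_distrib, ← Finset.mul_sum, Finset.sum_boole]
  simp

/-- the words of the three normalized rows -/
theorem wordOf_normalized {E : Fin 16 → Fin 7 → ℤ} (hN : IsNormalized E) : wordOf (E 0) = 0 ∧ wordOf (E 1) = 95 ∧ wordOf (E 2) = 63 := by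
  obtain ⟨h0, h1, h2⟩ := hN
  have e0 : E 0 = fun _ => 1 := funext h0
  have e1 : E 1 = fun x => if x = 5 then 1 else -1 := funext h1
  have e2 : E 2 = fun x => if x = 6 then 1 else -1 := funext h2
  rw [e0, e1, e2]
  refine ⟨by decide, by decide, by decide⟩

/-- **a normalized E-code yields a word code** -/
theorem IsECode.isWordCode {E : Fin 16 → Fin 7 → ℤ} (hN : IsNormalized E) (h : IsECode E) :
    IsWordCode (univ.image fun O => wordOf (E O)) := by
  have hinj : Function.Injective fun O => wordOf (E O) := fun O O' e => by
    by_contra hne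
    exact h.rows_ne O O' hne (wordOf_inj (h.sign O) (h.sign O') e)
  -- filters through the image
  have fcard : ∀ (p : ℕ → Prop) [DecidablePred p], ((univ.image fun O => wordOf (E O)).filter p).card = (univ.filter fun O => p (wordOf (E O))).card := by
    intro p _
    rw [Finset.filter_image, Finset.card_image_of_injective _ hinj]
  -- distances between rows
  have hd : ∀ O X, hdist (wordOf (E O)) (wordOf (E X)) = (univ.filter fun x : Fin 7 => E O x ≠ E X x).card := fun O X => hdist_wordOf (h.sign O) (h.sign X)
  have hi : ∀ O X, ∑ x, E O x * E X x = 7 - 2 * ((univ.filter fun x : Fin 7 => E O x ≠ E X x).card : ℤ) := fun O X => inner_signs (h.sign O) (h.sign X)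
  -- profile counts transported
  have prof : ∀ (O : Fin 16) (d : ℕ) (v : ℤ), (7 : ℤ) - 2 * d = v →
      ((univ.image fun O => wordOf (E O)).filter fun w => hdist (wordOf (E O)) w = d).card = (univ.filter fun X => ∑ x, E O x * E X x = v).card := by
    intro O d v hdv
    rw [fcard]
    congr 1
    ext X
    simp only [Finset.mem_filter, Finset.mem_univ, true_and, hd, hi]
    constructor
    · intro e; rw [e]; exact hdv
    · intro e; have : (2 : ℤ) * d = 2 * ((univ.filter fun x : Fin 7 => E O x ≠ E X x).card : ℤ) := by linarith
      exact_mod_cast (mul_left_cancel₀ (by norm_num : (2 : ℤ) ≠ 0) this).symm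
  obtain ⟨w0, w1, w2⟩ := wordOf_normalized hN
  refine ⟨?_, ?_, ?_, ?_, ?_, fun x => ?_, ?_, ?_, ?_, fun x y hxy => ?_⟩
  · rw [Finset.card_image_of_injective _ hinj]; simp
  · intro w hw
    obtain ⟨O, -, rfl⟩ := Finset.mem_image.1 hw
    exact wordOf_lt _
  · exact Finset.mem_image.2 ⟨0, mem_univ _, w0⟩
  · exact Finset.mem_image.2 ⟨1, mem_univ _, w1⟩
  · exact Finset.mem_image.2 ⟨2, mem_univ _, w2⟩
  · rw [fcard]
    have hb := h.balanced x
    rw [colsum_signs h.sign x] at hb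
    have e : (univ.filter fun O : Fin 16 => (wordOf (E O)).testBit x = true) = univ.filter fun O : Fin 16 => E O x = -1 := by
      ext O; simp [testBit_wordOf]
    rw [e]
    omega
  · intro v hv
    obtain ⟨O, -, rfl⟩ := Finset.mem_image.1 hv
    rw [prof O 6 (-5) (by norm_num)]; exact h.six O
  · intro v hv
    obtain ⟨O, -, rfl⟩ := Finset.mem_image.1 hv
    rw [prof O 4 (-1) (by norm_num)]; exact h.four O
  · intro v hv
    obtain ⟨O, -, rfl⟩ := Finset.mem_image.1 hv
    rw [prof O 2 3 (by norm_num)]; exact h.two O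
  · rw [fcard]
    have hc := h.corr x y hxy
    rw [corr_signs h.sign x y] at hc
    have e : (univ.filter fun O : Fin 16 => (wordOf (E O)).testBit x ≠ (wordOf (E O)).testBit y) = univ.filter fun O : Fin 16 => E O x ≠ E O y := by
      ext O
      simp only [Finset.mem_filter, Finset.mem_univ, true_and, testBit_wordOf]
      rcases h.sign O x with h1 | h1 <;> rcases h.sign O y with h2 | h2 <;> rw [h1, h2] <;> decide
    rw [e]
    omega

/-- **it suffices to refute word codes** -/
theorem noECodeNF_of_noWordCode (h0 : NoWordCode) : NoECodeNF := fun _ hN h => h0 _ (h.isWordCode hN)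

/-- hence `NoWordCode → NoECode` -/
theorem noECode_of_noWordCode (h0 : NoWordCode) : NoECode := noECode_of_noECodeNF (noECodeNF_of_noWordCode h0)

end FanoFive

/-- **The order-5 cell of PP(12) from the word-level coding statement** (the kernel-certificate entry point). -/
theorem noOrderFive_of_noWordCode (h0 : FanoFive.NoWordCode) : NoOrderFiveOrder12 :=
  noOrderFive_of_noECode (FanoFive.noECode_of_noWordCode h0)

end Summit.Ventures.DiscreteObjects.PP12
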